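import Literature.Computability.AlgebraicComplexity.DawarWilsenach2025Proofs
import Literature.Computability.AlgebraicComplexity.SymmetricThresholdTranslation
import Literature.ModelTheory.FiniteModelTheory.DawarWilsenach2025Thm72
import Literature.ModelTheory.FiniteModelTheory.SymmetricCircuitCountingWidthProofs
import HarnessLib

/-!
# Dawar–Wilsenach 2025, Theorem 7.1 (proved) — via Theorems 5.1, 6.4 and 7.2

Everything PROVED; no named facts. With Theorem 5.1 (`DawarWilsenach2025_thm51_family`,
`SymmetricThresholdTranslation.lean`) and Theorem 7.2 (`DawarWilsenach2025_thm72_family`,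
`DawarWilsenach2025Thm72.lean`) proved, the printed deduction of Theorem 7.1
(`DawarWilsenach2025_thm71_of_thm51_thm64_thm72`, `DawarWilsenach2025Proofs.lean`) leaves exactly the
named fact `DawarWilsenach2025_orbitSize_countingWidth` (Theorem 6.4) as hypothesis.

## References

* A. Dawar, G. Wilsenach, *Symmetric arithmetic circuits*, Theory of Computing 21 (2025), §7.1, proof
  of Thm. 7.1 (p. 19).
-/

namespace Literature.Computability.AlgebraicComplexity

/-- **Theorem 7.1 of Dawar–Wilsenach 2025 follows from Theorem 6.4 alone** (Theorems 5.1 and 7.2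
being proved in the tree): no family of square-symmetric arithmetic circuits of orbit size `2^{o(n)}`
over a field of characteristic `0` computes the permanent — GIVEN the named fact
`DawarWilsenach2025_orbitSize_countingWidth` (orbit size `2^{o(n)}` ⇒ counting width `o(n)`).
[cite: DawarWilsenach2025, §7.1 (proof of Thm. 7.1, p. 19)] -/
theorem DawarWilsenach2025_thm71_of_thm64
    (h64 : Literature.ModelTheory.FiniteModelTheory.DawarWilsenach2025_orbitSize_countingWidth) :
    DawarWilsenach2025_thm71 :=
  DawarWilsenach2025_thm71_of_thm51_thm64_thm72 DawarWilsenach2025_thm51_family h64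
    Literature.ModelTheory.FiniteModelTheory.CFIMatching.DawarWilsenach2025_thm72_family

/-- **Dawar–Wilsenach 2025, Theorem 7.1 (Main Theorem), PROVED**: there is no family of
square-symmetric arithmetic circuits of orbit size `2^{o(n)}` over a field of characteristic `0`
computing the permanent — the named fact `DawarWilsenach2025_thm71` holds.  All three ingredients
of the printed deduction (p. 19) are now theorems of the tree: Thm. 5.1
(`DawarWilsenach2025_thm51_family`), Thm. 6.4 (`DawarWilsenach2025_orbitSize_countingWidth_holds`,
from the Support Theorem `[16, Thm 4.10]` and Dixon–Mortimer Thm 5.2B) and Thm. 7.2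
(`DawarWilsenach2025_thm72_family`). [cite: DawarWilsenach2025, Thm. 7.1 (= Thm. 1.1), proof p. 19] -/
theorem DawarWilsenach2025_thm71_holds : DawarWilsenach2025_thm71 :=
  DawarWilsenach2025_thm71_of_thm64
    Literature.ModelTheory.FiniteModelTheory.DawarWilsenach2025_orbitSize_countingWidth_holds

end Literature.Computability.AlgebraicComplexity
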